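import Summits.AnomalousDissipation.AnomalousDissipation.Theorems.SolenoidalFractalHomogenisationLagrangianStepWEvenCertDefs
import Summits.AnomalousDissipation.AnomalousDissipation.Theorems.SolenoidalFractalHomogenisationLagrangianStepCellLawVEvenCertEnclosures110
import Summits.AnomalousDissipation.AnomalousDissipation.Theorems.SolenoidalFractalHomogenisationLagrangianStepCellLawVQSOddEven
import HarnessLib

/-!
# K1L_D IS-half · E1-CERT v2 port, part 2/5: major symmetrisation, block bilinear form and sectorial skew bound, the analytic leaves WIRED, the per-eigenvalue step

Summits-side PORT (prover seat `ad-sawtooth-k1loc-p1` g12; tenure E1-LAND 2026-08-29T00:31:55Z) of planner ad-ideate-p5 g12's certificate spine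
`Cruxes/LagrangianRenormalisationStep/Lines/onelevel_W_evenSlack_cert.lean` v2 (commit 88965dfa39cf; the mathematics, the numerics `evencert.py` / kit j321011
and the custody `HOME/ad-ideate-p5/k1l-even-cert/` are p5's) for the IS-half obligation `stub_W_evenSlackB : ∃ a > 0, WCrossing.EvenSlackWindowB a WCrossing.ρB`
of K1L_D `stub_cellLawV0_IS` (stmt-AnomalousDissipation-27980).  The port states everything over the LANDED `WCrossing` definitions
(`…LagrangianStepWCrossing`, prover ad-k1loc-p3 g7) instead of the spine's §W copies and wires the spine's three analytic stubs to landed theorems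
(`stub_oddEven ↦ oddEven_qsResp` p681750, `stub_N110U/L ↦ encl_N110U/L` p682297, point enclosures `↦ encl_N1xx` p681405); texts otherwise VERBATIM
(namespace `…LagrangianStep.WEvenCert`).  NOT a proof of `stub_cellLawV0_IS`, of the crux K1L_D, of Onsager's conjecture or of anomalous dissipation;
rung leaf F-D1.A0.

Part 2: §3.1 `symS` lemmas, §3.2 `regBlock_bilin`/`regBlock_skew`, §3.3 the leaves `stub_oddEven := oddEven_qsResp …`, `stub_N1xx := encl_N1xx`, `stub_N110U/L := encl_N110U/L` (all THEOREMS), §3.4 `form_qsResp_le_of_eig`/`le_form_qsResp_of_eig`.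
-/

set_option linter.dupNamespace false

noncomputable section

namespace Summit.AnomalousDissipation.AnomalousDissipation.Theorems.SolenoidalFractalHomogenisation.LagrangianStep.WEvenCert

open Summit.AnomalousDissipation.AnomalousDissipation.Theorems
open Summit.AnomalousDissipation.AnomalousDissipation.Theorems.SolenoidalFractalHomogenisation.LagrangianStep
open Summit.AnomalousDissipation.AnomalousDissipation.Theorems.SolenoidalFractalHomogenisation.LagrangianStep.WCrossing
open Literature.Analysis Literature.Analysis.FluidPDE Literature.Analysis.FunctionSpaces
open Literature.Algebra.EuclideanLattices (norm_sq_fin_three)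
open Set Real

/-! ## §3 Per-slot bounds from the block level (v2: the former per-slot stubs are THEOREMS modulo `stub_oddEven` + the two {110} enclosures; the four point enclosures cite `WEvenCertN`, p681593) -/

/-! ### §3.1 Major symmetrisation `½(S + Sᵀ)`: same transverse symbol, same order interval, no odd part; its block is `½(B̂ + B̂ᵀ)` -/


/-- `majorSymm_symS` (E1-CERT v2 spine §3.1–§3.4, p5 g12). -/
theorem majorSymm_symS (S : T4) : Torus.MajorSymm (symS S) :=
  (Torus.majorSymm_add_majorTranspose S).smul _

/-- `oddSmall_symS` (E1-CERT v2 spine §3.1–§3.4, p5 g12). -/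
theorem oddSmall_symS (S : T4) : Torus.OddSmall (symS S) 0 := (majorSymm_symS S).oddSmall 0

/-- `symb_symS` (E1-CERT v2 spine §3.1–§3.4, p5 g12). -/
theorem symb_symS (S : T4) (k p : Fin 3 → ℝ) : Torus.symb (symS S) k p = Torus.symb S k p := by
  unfold symS; rw [Torus.symb_smul, Torus.symb_add, Torus.symb_majorTranspose]; ring

/-- `inInterval_symS` (E1-CERT v2 spine §3.1–§3.4, p5 g12). -/
theorem inInterval_symS {Sstar S : T4} {lam : ℝ} (h : InInterval Sstar lam S) : InInterval Sstar lam (symS S) :=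
  ⟨fun k p hp => by rw [symb_symS]; exact h.1 k p hp, fun k p hp => by rw [symb_symS]; exact h.2 k p hp⟩

/-- `sigMat_symS` (E1-CERT v2 spine §3.1–§3.4, p5 g12). -/
theorem sigMat_symS (S : T4) (n : Fin 3 → ℝ) (i j : Fin 3) :
    sigMat (symS S) n i j = (sigMat S n i j + sigMat S n j i) / 2 := by
  simp only [sigMat, symS, Pi.smul_apply, Pi.add_apply, smul_eq_mul, Torus.majorTranspose_apply, Fin.sum_univ_three]
  ring

/-- the block of the symmetrisation is the symmetrisation of the block. [folklore] -/
theorem regBlock_symS (S : T4) (n : Fin 3 → ℝ) :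
    regBlock (symS S) n = (1 / 2 : ℝ) • (regBlock S n + (regBlock S n).transpose) := by
  ext i j
  simp only [regBlock, Matrix.add_apply, Matrix.smul_apply, Matrix.transpose_apply, smul_eq_mul, Matrix.mul_apply,
    Matrix.vecMulVec_apply, sigMat_symS, Fin.sum_univ_three]
  have hP : ∀ a b : Fin 3, projPerp n a b = projPerp n b a := fun a b => projPerp_apply_comm n a b
  rw [hP 0 i, hP 1 i, hP 2 i, hP j 0, hP j 1, hP j 2]
  ring

/-! ### §3.2 The bilinear form of the block and the sectorial skew bound -/

/-- `projPerp_transpose` (E1-CERT v2 spine §3.1–§3.4, p5 g12). -/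
theorem projPerp_transpose (n : Fin 3 → ℝ) : (projPerp n).transpose = projPerp n := by
  ext i j; exact projPerp_apply_comm n j i

/-- `uᵀ B̂(S,n) w = β_S(n; P u, P w) + (n·u)(n·w)` for a unit `n` (any `S`). [folklore] -/
theorem regBlock_bilin (n : Fin 3 → ℝ) (S : T4) (u w : Fin 3 → ℝ) :
    ∑ i, ∑ j, u i * regBlock S n i j * w j
      = Torus.bsymb S n ((projPerp n).mulVec u) ((projPerp n).mulVec w) + (∑ i, n i * u i) * (∑ i, n i * w i) := by
  rw [← sum_sum_mul_sigMat_mul, ← sum_mul_mulVec_eq_sum_sum, ← sum_mul_mulVec_eq_sum_sum, regBlock, Matrix.add_mulVec,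
    ← Matrix.mulVec_mulVec, ← Matrix.mulVec_mulVec]
  have h1 : ∑ i, u i * ((projPerp n).mulVec ((sigMat S n).mulVec ((projPerp n).mulVec w)) + (Matrix.vecMulVec n n).mulVec w) i
      = u ⬝ᵥ (projPerp n).mulVec ((sigMat S n).mulVec ((projPerp n).mulVec w)) + u ⬝ᵥ (Matrix.vecMulVec n n).mulVec w := by
    simp only [Pi.add_apply, mul_add, Finset.sum_add_distrib, dotProduct]
  have hvm : Matrix.vecMul u (projPerp n) = (projPerp n).mulVec u := by rw [← Matrix.vecMul_transpose, projPerp_transpose]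
  rw [h1, Matrix.dotProduct_mulVec u (projPerp n), hvm]
  simp only [dotProduct, Matrix.mulVec, Matrix.vecMulVec_apply, Fin.sum_univ_three]
  ring

/-- **Sectorial skew bound for the block.**  `Sc/λ ≼ S ≼ λSc` and `OddSectorial S τ` give
`(uᵀB̂w − wᵀB̂u)² ≤ 4(τλ/2)²|u|²|w|²` at every unit `n` (`4ω² = τ²λ²`). [folklore] -/
theorem regBlock_skew {n : Fin 3 → ℝ} (hn : ∑ a, n a ^ 2 = 1) {S : T4} {τ lam : ℝ} (_hτ : 0 ≤ τ) (hlam : 1 ≤ lam)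
    (hI : InInterval Sc lam S) (hO : OddSectorial S τ) (u w : Fin 3 → ℝ) :
    (∑ i, ∑ j, u i * regBlock S n i j * w j - ∑ i, ∑ j, w i * regBlock S n i j * u j) ^ 2
      ≤ 4 * (τ * lam / 2) ^ 2 * (∑ i, u i ^ 2) * (∑ i, w i ^ 2) := by
  rw [regBlock_bilin, regBlock_bilin]
  set u' := (projPerp n).mulVec u
  set w' := (projPerp n).mulVec w
  have hu' : ∑ i, u' i * n i = 0 := sum_projPerp_mulVec_mul hn u
  have hw' : ∑ i, w' i * n i = 0 := sum_projPerp_mulVec_mul hn w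
  have hodd := hO n u' w' hu' hw'
  have hn1 : ∑ a, n a ^ 2 = 1 := hn
  -- windows: 0 ≤ symb S n u' ≤ lam |u|²
  have hSu := (hI.2 n u' hu'); have hSw := (hI.2 n w' hw')
  have hSu0 := (hI.1 n u' hu'); have hSw0 := (hI.1 n w' hw')
  rw [Torus.symb_smul] at hSu hSw hSu0 hSw0
  have hcu := (nearIso_Sc n u' hu'); have hcw := (nearIso_Sc n w' hw')
  rw [hn1] at hcu hcw
  have hPu : ∑ i, u' i ^ 2 = ∑ i, u i ^ 2 - (∑ i, u i * n i) ^ 2 := sum_sq_projPerp_mulVec hn u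
  have hPw : ∑ i, w' i ^ 2 = ∑ i, w i ^ 2 - (∑ i, w i * n i) ^ 2 := sum_sq_projPerp_mulVec hn w
  have hslo : (0:ℝ) < sloC := by unfold sloC; norm_num
  have hl0 : 0 < lam := by linarith
  have hA0 : 0 ≤ Torus.symb S n u' := by
    have : 0 ≤ Torus.symb Sc n u' := by nlinarith [hcu.1, Nkp_nonneg n u', show 0 ≤ ∑ i, u' i ^ 2 by positivity]
    have h2 : 0 ≤ 1 / lam * Torus.symb Sc n u' := by positivity
    linarith
  have hB0 : 0 ≤ Torus.symb S n w' := by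
    have : 0 ≤ Torus.symb Sc n w' := by nlinarith [hcw.1, show 0 ≤ ∑ i, w' i ^ 2 by positivity]
    have h2 : 0 ≤ 1 / lam * Torus.symb Sc n w' := by positivity
    linarith
  have hAu : Torus.symb S n u' ≤ lam * ∑ i, u i ^ 2 := by
    have h1 : Torus.symb Sc n u' ≤ ∑ i, u i ^ 2 := by nlinarith [hcu.2, sq_nonneg (∑ i, u i * n i)]
    nlinarith
  have hBw : Torus.symb S n w' ≤ lam * ∑ i, w i ^ 2 := by
    have h1 : Torus.symb Sc n w' ≤ ∑ i, w i ^ 2 := by nlinarith [hcw.2, sq_nonneg (∑ i, w i * n i)]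
    nlinarith
  have hprod : Torus.symb S n u' * Torus.symb S n w' ≤ (lam * ∑ i, u i ^ 2) * (lam * ∑ i, w i ^ 2) :=
    mul_le_mul hAu hBw hB0 (by positivity)
  have hsq : (Torus.bsymb S n u' w' + (∑ i, n i * u i) * (∑ i, n i * w i) -
      (Torus.bsymb S n w' u' + (∑ i, n i * w i) * (∑ i, n i * u i))) ^ 2 = (Torus.bsymb S n u' w' - Torus.bsymb S n w' u') ^ 2 := by ring
  rw [hsq]
  calc (Torus.bsymb S n u' w' - Torus.bsymb S n w' u') ^ 2 ≤ τ ^ 2 * (Torus.symb S n u' * Torus.symb S n w') := hodd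
    _ ≤ τ ^ 2 * ((lam * ∑ i, u i ^ 2) * (lam * ∑ i, w i ^ 2)) := mul_le_mul_of_nonneg_left hprod (sq_nonneg τ)
    _ = 4 * (τ * lam / 2) ^ 2 * (∑ i, u i ^ 2) * (∑ i, w i ^ 2) := by ring

/-! ### §3.3 The analytic stubs: S2 (sectorial odd–even comparison, matrix level) and the two {110} interval enclosures; the four point enclosures cite `WEvenCertN` (p681593) -/

/-- **STUB S2 (odd–even comparison; prover ad-sawtooth-k1loc-p1 g12, `…CellLawVQSOddEven.lean`).**  For a real `3×3` matrix `B` with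
`b|w|² ≤ wᵀBw` (`b > 0`) and skew part `(uᵀBw − wᵀBu)² ≤ 4ω²|u|²|w|²`, the quasi-static responses of `B` and of its symmetric part differ by at most
`ω²/b³` in form sense: `|vᵀ f_T(B) v − vᵀ f_T(½(B+Bᵀ)) v| ≤ (ω²/b³)|v|²`.  Energy proof: `u = e^{−tB}v`, `ū = e^{−tBᵀ}v`, `z = e^{−tB_s}v`;
`|u−z|, |ū−z| ≤ ωt e^{−tb}|v|`, `|u+ū−2z| ≤ ω²t²e^{−tb}|v|`, so `|vᵀe^{−tB}v − vᵀe^{−tB_s}v| ≤ (ω²t²/2)e^{−tb}|v|²`; integrate against the slot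
weights (`0 ≤ a ≤ 1`) with `∫₀^∞ t²e^{−tb} = 2/b³`. -/
theorem stub_oddEven (B : Matrix (Fin 3) (Fin 3) ℝ) {b ω ρ T : ℝ} (hb : 0 < b)
    (hfloor : ∀ w : Fin 3 → ℝ, b * ∑ i, w i ^ 2 ≤ ∑ i, ∑ j, w i * B i j * w j)
    (hskew : ∀ u w : Fin 3 → ℝ, (∑ i, ∑ j, u i * B i j * w j - ∑ i, ∑ j, w i * B i j * u j) ^ 2
      ≤ 4 * ω ^ 2 * (∑ i, u i ^ 2) * (∑ i, w i ^ 2))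
    (_hρ : 0 < ρ) (_hρ2 : ρ ≤ 1 / 2) (hT : 0 ≤ T) (v : Fin 3 → ℝ) :
    |∑ i, ∑ j, v i * qsResp ρ T B i j * v j - ∑ i, ∑ j, v i * qsResp ρ T ((1 / 2 : ℝ) • (B + B.transpose)) i j * v j|
      ≤ ω ^ 2 / b ^ 3 * ∑ i, v i ^ 2 :=
  oddEven_qsResp B v hb hfloor hskew ρ hT


/-- **STUB N100U** (`f₁₀₀(1/λ₀) ≤ U100'`; closed form `qsRespScalar_eq_closed_form` + exp enclosures; gap `1.0·10⁻⁷`). -/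
theorem stub_N100U : qsRespScalar (1 / 2) T100 (1 / lam0) ≤ U100p := by
  unfold T100 MB lam0 U100p
  exact encl_N100U

/-- **STUB N100L** (`L100' ≤ λ₀ f₁₀₀(λ₀)`; gap `1.0·10⁻⁷`). -/
theorem stub_N100L : L100p ≤ lam0 * qsRespScalar (1 / 2) T100 (lam0 * 1) := by
  unfold T100 MB lam0 L100p
  exact encl_N100L

/-- **STUB N111U** (`f₁₁₁(β₁₁₁/λ₀) ≤ U111'`; gap `1.0·10⁻⁷`). -/
theorem stub_N111U : qsRespScalar (1 / 2) T111 (β111 / lam0) ≤ U111p := by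
  unfold T111 MB β111 κc lam0 U111p
  exact encl_N111U

/-- **STUB N111L** (`L111' ≤ λ₀ f₁₁₁(λ₀β₁₁₁)`; gap `1.0·10⁻⁷`). -/
theorem stub_N111L : L111p ≤ lam0 * qsRespScalar (1 / 2) T111 (lam0 * β111) := by
  unfold T111 MB β111 κc lam0 L111p
  exact encl_N111L

/-- **STUB N110U** (tangent majorant of the concave `u ↦ f₁₁₀(1/(λ₀u)) = λ₀u·ϑ(½, T₁₁₀/(λ₀u))` at `u₀ = ½(1 + 1/β_d)`; min gap `1.0·10⁻⁷` at `u₀`). -/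
theorem stub_N110U : ∀ u ∈ Set.Icc (83 / 100 : ℝ) (1002 / 1000), qsRespScalar (1 / 2) T110 (1 / (lam0 * u)) ≤ UAp + UB * u := by
  unfold T110 MB lam0 UAp UB
  exact encl_N110U

/-- **STUB N110L** (tangent minorant of the convex `x ↦ λ₀ f₁₁₀(λ₀x)` at `x₀ = ½(1 + β_d)`; min gap `1.0·10⁻⁷` at `x₀`). -/
theorem stub_N110L : ∀ x ∈ Set.Icc (83 / 100 : ℝ) 1, LAp + LB * x ≤ lam0 * qsRespScalar (1 / 2) T110 (lam0 * x) := by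
  unfold T110 MB lam0 LAp LB
  exact encl_N110L



/-! ### §3.4 The per-eigenvalue step for a SYMMETRIC block (used for the {110} slots; eigenbasis from Mathlib's spectral theorem) -/

/-- **UPPER per-eigenvalue step.**  `Bs` symmetric, `a|w|² ≤ wᵀBs w ≤ c|w|²` (`a > 0`), `(1/λ)R(w) ≤ wᵀBs w` for a reference form `R`,
`λ ≥ λ₀`; an affine majorant `f_T(1/(λ₀u)) ≤ A + B·u` (`B ≥ 0`) on the range of `u = 1/(λγ)`, `γ ∈ [a,c]` (ray reduction
`f(γ) ≤ (λ/λ₀) f(λγ/λ₀)`, `qsRespScalar_div_antitone_ray`); and the inverse-form majorant `B(2λ v·w − R(w)) ≤ λ²·B·Y` for all `w`.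
Then `vᵀ f_T(Bs) v ≤ (λ/λ₀)(A|v|² + B·Y)` (Parseval + `Σ_k (q_k·v)²/γ_k = 2v·w⋆ − w⋆ᵀBs w⋆`). [folklore] -/
theorem form_qsResp_le_of_eig {Bs : Matrix (Fin 3) (Fin 3) ℝ} (hBs : Bs.IsSymm) {lam a c T A B Y ulo uhi : ℝ}
    (R : (Fin 3 → ℝ) → ℝ) (v : Fin 3 → ℝ) (hlam : lam0 ≤ lam) (ha0 : 0 < a)
    (ha : ∀ w : Fin 3 → ℝ, a * ∑ i, w i ^ 2 ≤ ∑ i, ∑ j, w i * Bs i j * w j)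
    (hc : ∀ w : Fin 3 → ℝ, ∑ i, ∑ j, w i * Bs i j * w j ≤ c * ∑ i, w i ^ 2)
    (hR : ∀ w : Fin 3 → ℝ, 1 / lam * R w ≤ ∑ i, ∑ j, w i * Bs i j * w j)
    (hT : 0 < T) (hB : 0 ≤ B)
    (hu : ∀ γ, a ≤ γ → γ ≤ c → ulo ≤ 1 / (lam * γ) ∧ 1 / (lam * γ) ≤ uhi)
    (hN : ∀ u ∈ Set.Icc ulo uhi, qsRespScalar (1 / 2) T (1 / (lam0 * u)) ≤ A + B * u)
    (hY : ∀ w : Fin 3 → ℝ, B * (2 * lam * ∑ i, v i * w i - R w) ≤ lam ^ 2 * B * Y) :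
    ∑ i, ∑ j, v i * qsResp (1 / 2) T Bs i j * v j ≤ lam / lam0 * (A * ∑ i, v i ^ 2 + B * Y) := by
  have hH : Bs.IsHermitian := isHermitian_of_isSymm hBs
  set e := hH.eigenvectorBasis with he
  set γ := hH.eigenvalues with hγ
  have heq : ∀ k, Bs.mulVec (e k) = γ k • ⇑(e k) := fun k => hH.mulVec_eigenvectorBasis k
  have hγa : ∀ k, a ≤ γ k := fun k => le_eig_of_loewner_floor e γ heq ha k
  have hγpos : ∀ k, 0 < γ k := fun k => lt_of_lt_of_le ha0 (hγa k)
  have hγc : ∀ k, γ k ≤ c := fun k => eig_le_of_loewner_ceiling e γ heq hc k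
  have hl0 : 0 < lam := lt_of_lt_of_le lam0_pos hlam
  rw [sum_sum_mul_qsResp_mul_self_eq_sum_eig hBs e γ heq]
  have hpars : ∑ i, v i ^ 2 = ∑ k, (∑ i, e k i * v i) ^ 2 := by
    have h := sum_mul_eq_sum_eig e v v
    simpa only [sq] using h
  have hdir : ∀ k, qsRespScalar (1 / 2) T (γ k) ≤ lam / lam0 * (A + B * (1 / (lam * γ k))) := by
    intro k
    have hray := qsRespScalar_div_antitone_ray (ρ := 1 / 2) (T := T) (β := lam * γ k) (by norm_num) (by norm_num) hT
      (mul_pos hl0 (hγpos k)) lam0_pos hlam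
    have e1 : lam * γ k / lam = γ k := by field_simp
    rw [e1] at hray
    have huk := hu (γ k) (hγa k) (hγc k)
    have hNk := hN (1 / (lam * γ k)) ⟨huk.1, huk.2⟩
    have e2 : 1 / (lam0 * (1 / (lam * γ k))) = lam * γ k / lam0 := by
      have := (hγpos k).ne'; have := hl0.ne'; have := lam0_pos.ne'; field_simp
    rw [e2] at hNk
    have h3 : qsRespScalar (1 / 2) T (γ k) ≤ lam * (qsRespScalar (1 / 2) T (lam * γ k / lam0) / lam0) := by
      rw [div_le_iff₀ hl0] at hray; linarith [hray]
    calc qsRespScalar (1 / 2) T (γ k) ≤ lam * (qsRespScalar (1 / 2) T (lam * γ k / lam0) / lam0) := h3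
      _ ≤ lam * ((A + B * (1 / (lam * γ k))) / lam0) :=
          mul_le_mul_of_nonneg_left (div_le_div_of_nonneg_right hNk lam0_pos.le) hl0.le
      _ = lam / lam0 * (A + B * (1 / (lam * γ k))) := by ring
  have hsum : ∑ k, qsRespScalar (1 / 2) T (γ k) * (∑ i, e k i * v i) ^ 2
      ≤ ∑ k, lam / lam0 * (A + B * (1 / (lam * γ k))) * (∑ i, e k i * v i) ^ 2 :=
    Finset.sum_le_sum fun k _ => mul_le_mul_of_nonneg_right (hdir k) (sq_nonneg _)
  have hsplit : ∑ k, lam / lam0 * (A + B * (1 / (lam * γ k))) * (∑ i, e k i * v i) ^ 2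
      = lam / lam0 * (A * ∑ k, (∑ i, e k i * v i) ^ 2 + B / lam * ∑ k, (∑ i, e k i * v i) ^ 2 / γ k) := by
    rw [Finset.mul_sum, Finset.mul_sum, ← Finset.sum_add_distrib, Finset.mul_sum]
    refine Finset.sum_congr rfl fun k _ => ?_
    have := (hγpos k).ne'; have := hl0.ne'
    field_simp
  set ws : Fin 3 → ℝ := fun i => ∑ k, ((∑ j, e k j * v j) / γ k) * e k i with hws
  have hinv : ∑ k, (∑ i, e k i * v i) ^ 2 / γ k = 2 * ∑ i, v i * ws i - ∑ i, ∑ j, ws i * Bs i j * ws j :=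
    (two_mul_sub_quad_eq_inv_form hBs e γ heq v).symm
  have hinv_le : B / lam * ∑ k, (∑ i, e k i * v i) ^ 2 / γ k ≤ B * Y := by
    rw [hinv]
    have h1 := hR ws
    have h2 := hY ws
    have hBl : 0 ≤ B / lam := div_nonneg hB hl0.le
    have h3 : B / lam * (2 * ∑ i, v i * ws i - ∑ i, ∑ j, ws i * Bs i j * ws j)
        ≤ B / lam * (2 * ∑ i, v i * ws i - 1 / lam * R ws) :=
      mul_le_mul_of_nonneg_left (by linarith) hBl
    have h4 : B / lam * (2 * ∑ i, v i * ws i - 1 / lam * R ws) = (B * (2 * lam * ∑ i, v i * ws i - R ws)) / lam ^ 2 := by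
      field_simp
    have h5 : (B * (2 * lam * ∑ i, v i * ws i - R ws)) / lam ^ 2 ≤ lam ^ 2 * B * Y / lam ^ 2 :=
      div_le_div_of_nonneg_right h2 (by positivity)
    have h6 : lam ^ 2 * B * Y / lam ^ 2 = B * Y := by field_simp
    linarith [h3, h4.le, h4.ge, h5, h6.le, h6.ge]
  calc ∑ k, qsRespScalar (1 / 2) T (γ k) * (∑ i, e k i * v i) ^ 2
      ≤ lam / lam0 * (A * ∑ k, (∑ i, e k i * v i) ^ 2 + B / lam * ∑ k, (∑ i, e k i * v i) ^ 2 / γ k) := by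
        rw [← hsplit]; exact hsum
    _ ≤ lam / lam0 * (A * ∑ i, v i ^ 2 + B * Y) := by
        rw [← hpars]
        exact mul_le_mul_of_nonneg_left (by linarith [hinv_le]) (div_nonneg hl0.le lam0_pos.le)

/-- **LOWER per-eigenvalue step.**  `Bs` symmetric, `a|w|² ≤ wᵀBs w ≤ c|w|²` (`a > 0`), `vᵀBs v ≤ λ R(v)`, `λ ≥ λ₀`; an affine minorant
`A' + B'x ≤ λ₀ f_T(λ₀ x)` (`B' ≤ 0`) on the range of `x = γ/λ`, `γ ∈ [a,c]` (ray reduction `λ f(γ) ≥ λ₀ f(λ₀γ/λ)`,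
`mul_qsRespScalar_mul_mono_ray`).  Then `(1/λ)(A'|v|² + B'·R(v)) ≤ vᵀ f_T(Bs) v` (Parseval + `Σ_k γ_k (q_k·v)² = vᵀBs v`). [folklore] -/
theorem le_form_qsResp_of_eig {Bs : Matrix (Fin 3) (Fin 3) ℝ} (hBs : Bs.IsSymm) {lam a c T A' B' xlo xhi : ℝ}
    (R : (Fin 3 → ℝ) → ℝ) (v : Fin 3 → ℝ) (hlam : lam0 ≤ lam) (ha0 : 0 < a)
    (ha : ∀ w : Fin 3 → ℝ, a * ∑ i, w i ^ 2 ≤ ∑ i, ∑ j, w i * Bs i j * w j)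
    (hc : ∀ w : Fin 3 → ℝ, ∑ i, ∑ j, w i * Bs i j * w j ≤ c * ∑ i, w i ^ 2)
    (hRv : ∑ i, ∑ j, v i * Bs i j * v j ≤ lam * R v)
    (hT : 0 < T) (hB' : B' ≤ 0)
    (hx : ∀ γ, a ≤ γ → γ ≤ c → xlo ≤ γ / lam ∧ γ / lam ≤ xhi)
    (hN : ∀ x ∈ Set.Icc xlo xhi, A' + B' * x ≤ lam0 * qsRespScalar (1 / 2) T (lam0 * x)) :
    1 / lam * (A' * ∑ i, v i ^ 2 + B' * R v) ≤ ∑ i, ∑ j, v i * qsResp (1 / 2) T Bs i j * v j := by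
  have hH : Bs.IsHermitian := isHermitian_of_isSymm hBs
  set e := hH.eigenvectorBasis with he
  set γ := hH.eigenvalues with hγ
  have heq : ∀ k, Bs.mulVec (e k) = γ k • ⇑(e k) := fun k => hH.mulVec_eigenvectorBasis k
  have hγa : ∀ k, a ≤ γ k := fun k => le_eig_of_loewner_floor e γ heq ha k
  have hγpos : ∀ k, 0 < γ k := fun k => lt_of_lt_of_le ha0 (hγa k)
  have hγc : ∀ k, γ k ≤ c := fun k => eig_le_of_loewner_ceiling e γ heq hc k
  have hl0 : 0 < lam := lt_of_lt_of_le lam0_pos hlam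
  have hBv : ∑ i, ∑ j, v i * Bs i j * v j = ∑ k, γ k * (∑ i, e k i * v i) ^ 2 := by
    rw [sum_sum_mul_mul_eq_sum_eig hBs e γ heq v v]
    exact Finset.sum_congr rfl fun k _ => by rw [sq]
  rw [sum_sum_mul_qsResp_mul_self_eq_sum_eig hBs e γ heq]
  have hpars : ∑ i, v i ^ 2 = ∑ k, (∑ i, e k i * v i) ^ 2 := by
    have h := sum_mul_eq_sum_eig e v v
    simpa only [sq] using h
  have hdir : ∀ k, 1 / lam * (A' + B' * (γ k / lam)) ≤ qsRespScalar (1 / 2) T (γ k) := by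
    intro k
    have hray := mul_qsRespScalar_mul_mono_ray (ρ := 1 / 2) (T := T) (β := γ k / lam) (by norm_num) (by norm_num) hT
      (div_pos (hγpos k) hl0) lam0_pos hlam
    have e1 : lam * (γ k / lam) = γ k := by field_simp
    rw [e1] at hray
    have hxk := hx (γ k) (hγa k) (hγc k)
    have hNk := hN (γ k / lam) ⟨hxk.1, hxk.2⟩
    have h3 : A' + B' * (γ k / lam) ≤ lam * qsRespScalar (1 / 2) T (γ k) := le_trans hNk hray
    rw [one_div, ← div_eq_inv_mul]
    exact (div_le_iff₀ hl0).2 (by linarith [h3])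
  have hsum : ∑ k, 1 / lam * (A' + B' * (γ k / lam)) * (∑ i, e k i * v i) ^ 2
      ≤ ∑ k, qsRespScalar (1 / 2) T (γ k) * (∑ i, e k i * v i) ^ 2 :=
    Finset.sum_le_sum fun k _ => mul_le_mul_of_nonneg_right (hdir k) (sq_nonneg _)
  have hsplit : ∑ k, 1 / lam * (A' + B' * (γ k / lam)) * (∑ i, e k i * v i) ^ 2
      = 1 / lam * (A' * ∑ k, (∑ i, e k i * v i) ^ 2 + B' / lam * ∑ k, γ k * (∑ i, e k i * v i) ^ 2) := by
    rw [Finset.mul_sum, Finset.mul_sum, ← Finset.sum_add_distrib, Finset.mul_sum]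
    refine Finset.sum_congr rfl fun k _ => ?_
    have := hl0.ne'
    field_simp
  have hlow : B' * R v ≤ B' / lam * ∑ k, γ k * (∑ i, e k i * v i) ^ 2 := by
    rw [← hBv]
    have hBl : B' / lam ≤ 0 := div_nonpos_of_nonpos_of_nonneg hB' hl0.le
    have h1 : B' / lam * (lam * R v) ≤ B' / lam * ∑ i, ∑ j, v i * Bs i j * v j := mul_le_mul_of_nonpos_left hRv hBl
    have h2 : B' / lam * (lam * R v) = B' * R v := by field_simp
    linarith [h1, h2.le, h2.ge]
  calc 1 / lam * (A' * ∑ i, v i ^ 2 + B' * R v)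
      ≤ 1 / lam * (A' * ∑ k, (∑ i, e k i * v i) ^ 2 + B' / lam * ∑ k, γ k * (∑ i, e k i * v i) ^ 2) := by
        rw [← hpars]
        exact mul_le_mul_of_nonneg_left (by linarith [hlow]) (by positivity)
    _ = ∑ k, 1 / lam * (A' + B' * (γ k / lam)) * (∑ i, e k i * v i) ^ 2 := hsplit.symm
    _ ≤ _ := hsum


end Summit.AnomalousDissipation.AnomalousDissipation.Theorems.SolenoidalFractalHomogenisation.LagrangianStep.WEvenCert
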